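import Summits.Ventures.YMGap.Thresholds.ConnectedThreePointToolsDim
import Summits.Ventures.YMGap.Thresholds.ConnectedThreePointDecay
import HarnessLib

/-!
# Venture YMGap — C-SUS3 FOR EVERY `SU(N)` IN EVERY DIMENSION `d ≥ 2`: tree decay and absolute summability of the connected
# three-point function of the strong-coupling state on `ℤ^d`, hypothesis-free for `N ≥ 2` at 't Hooft `(d−1)b/N ≤ 1/12`

HONEST FRAMING: venture file of the cell `pub-ymgap` (QuantumFields programme), seat ds-1 (gen 10).  Strong-coupling
LATTICE statements for `SU(N)` lattice Yang–Mills on `ℤ^d` with the Wilson action at tree coupling `b` inside the one-sided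
vertex-star window fed by a one-link KR modulus (`6 b₁/N ≤ R`, `4K b₁/N ≤ 9/25`); cumulant estimates of the unique DLR state
only; nothing about the continuum, confinement at weak coupling, or the Clay problem.  Every-`d` twin of
`ConnectedThreePointDecaySUN` (`W_q = (1/N) Re tr U_q`, plaquette constant `w = 4N³`, decay ratio `r = e^{−κ/(4d)}`).

For `κ = κ_d(R_G^{(d)}(K b₁/N))`, `r = e^{−κ/(4d)}`, a Lipschitz cylinder `F` (support `Λ`, constant `K_F`, links within
`D` of `x₀`, `M = |F(1)| + 2K_F`), the DLR state `μ` at ANY `0 ≤ b ≤ b₁`: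
* ★ `abs_threePoint_le_dim` — `|u₃(F; W_q; W_r)| ≤ A_N · r^{‖x₀−x_q‖₁} (r^{‖x₀−x_r‖₁} + r^{‖x_q−x_r‖₁})`,
  `A_N = 4(2√N)² e^{κ(D+4)} (4w(#Λ+4)(wM+K_F) + 16 M w² + 24 w #Λ K_F)`;
* ★ `summable_threePoint_dim` — `Σ_r |u₃(F; W_q; W_r)| ≤ 2 A_N D₄((1+r)/(1−r))⁴ r^{‖x₀−x_q‖₁}`, summable again in `q`;
* ★ `summable_threePoint_dim_thooft` — every `N ≥ 2`, HYPOTHESIS-FREE (Bakry–Émery modulus), every `0 ≤ b ≤ N/(12(d−1))`.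

References (mechanism only): R. L. Dobrushin, S. B. Shlosman (1985/87); M. Duneau, D. Iagolnitzer, B. Souillard, CMP 31
(1973) 191.
-/

noncomputable section

open MeasureTheory ProbabilityTheory Function Finset Filter Topology Real Set
open scoped NNReal
open Literature.MathematicalPhysics.QuantumLattice (LGConfig ZdEdge ZdPlaquette plaquetteEdges fundamentalRep
  ymGibbsMeasures)
open Literature.MathematicalPhysics.QuantumFieldTheory hiding ZdEdge
open Literature.MathematicalPhysics.QuantumFieldTheory.Balaban1983to89.StrongCouplingDobrushinWindow (OneLinkKRModulus)
open Literature.MathematicalPhysics.QuantumFieldTheory.Balaban1983to89.StrongCouplingKernelWindow (oneLinkKRModulus_SU)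
open Summit.Ventures.YMGap.StarResolventDim (gaugeR doorPoly)
open Summit.Ventures.YMGap.StarLemmaG (gaugeR_nonneg)
open Summit.Ventures.YMGap.RobustBall (l1 l1_sub_comm numOrient)
open Summit.Ventures.YMGap.LinearResponseBound (summable_and_tsum_base_le)

namespace Summit.Ventures.YMGap.CouplingResponse

variable {d N : ℕ}

/-- Local shorthand: the any-`d` Dobrushin–Shlosman rate `κ_d(R_G^{(d)}(c)) = (1 − ρ)²/(2(2ρ·2d + 1))`, `ρ = R_G^{(d)}(c)`. -/
local notation3 (prettyPrint := false) "dimκ(" d' ", " c ")" =>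
  (1 - gaugeR d' c) ^ 2 / (2 * (2 * gaugeR d' c * ((2 * d' : ℕ) : ℝ) + 1))

/-- Local shorthand: the normalised plaquette observable `W_q = (1/N) Re tr U_q` of `SU(N)` on `ℤ^d`. -/
local notation3 (prettyPrint := false) "W∗" q:max =>
  zdPlaquetteObs (d := d) (fundamentalRep (Fin N)) (Prod.fst q) (Prod.snd q).1.1 (Prod.snd q).1.2

/-- ★ **TREE DECAY OF THE CONNECTED THREE-POINT FUNCTION, `SU(N)` on `ℤ^d`** (ONE constant for the whole modulus window):
`|u₃(F; W_q; W_r)| ≤ A_N · r^{‖x₀−x_q‖₁} · (r^{‖x₀−x_r‖₁} + r^{‖x_q−x_r‖₁})`, `r = e^{−κ/(4d)}`, `κ = κ_d(R_G^{(d)}(K b₁/N))`,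
`A_N = 4(2√N)² e^{κ(D+4)} (4w(#Λ+4)(wM+K_F) + 16Mw² + 24w#ΛK_F)`, `w = 4N³`, `M = |F(1)| + 2K_F` — three splits
(`abs_threePoint_le_of_sep_dim`) and `tree_bound_of_three_splits`. -/
theorem abs_threePoint_le_dim (hd : 2 ≤ d) (hN : 1 ≤ N) {R K b₁ : ℝ} (hK0 : 0 ≤ K)
    (hmod : OneLinkKRModulus N R K) (hR : b₁ / N * (2 * ((d : ℝ) - 1)) ≤ R) (hdoor : doorPoly d (K * (b₁ / N)) < 1) {b : ℝ} (h0 : 0 ≤ b) (hb : b ≤ b₁)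
    {μ : Measure (LGConfig d (Matrix.specialUnitaryGroup (Fin N) ℂ))}
    (hμ : μ ∈ ymGibbsMeasures (d := d) (fundamentalRep (Fin N)) b)
    {F : LGConfig d (Matrix.specialUnitaryGroup (Fin N) ℂ) → ℝ} {Λ : Finset (ZdEdge d)} {KF : ℝ≥0}
    (hF : IsLipschitzCylinder (fundamentalRep (Fin N)) F Λ KF)
    {x₀ : Literature.Probability.LatticeModels.Site d} {D : ℕ} (hD : ∀ e ∈ Λ, ‖e.1 - x₀‖ ≤ D)
    (q r : ZdPlaquette d) :
    |cov[fun U => F U * (W∗ q) U, W∗ r; μ] - (∫ U, F U ∂μ) * cov[W∗ q, W∗ r; μ] -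
        (∫ U, (W∗ q) U ∂μ) * cov[F, W∗ r; μ]| ≤
      4 * (2 * Real.sqrt N) ^ 2 * Real.exp (dimκ(d, K * (b₁ / N)) * (D + 4)) *
        (4 * (4 * (N : ℝ) ^ 3) * (((Λ.card : ℝ) + 4) * (4 * (N : ℝ) ^ 3 * (|F 1| + 2 * KF) + KF)) +
          16 * (|F 1| + 2 * KF) * (4 * (N : ℝ) ^ 3) ^ 2 + 24 * (4 * (N : ℝ) ^ 3) * ((Λ.card : ℝ) * KF)) *
        Real.exp (-(dimκ(d, K * (b₁ / N)) / (4 * d))) ^ l1 (x₀ - q.1) *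
        (Real.exp (-(dimκ(d, K * (b₁ / N)) / (4 * d))) ^ l1 (x₀ - r.1) +
          Real.exp (-(dimκ(d, K * (b₁ / N)) / (4 * d))) ^ l1 (q.1 - r.1)) := by
  classical
  haveI : IsProbabilityMeasure μ := hμ.1
  have hN0 : (0 : ℝ) < N := by exact_mod_cast (show 0 < N by omega)
  have hb₁N : 0 ≤ b₁ / N := div_nonneg (h0.trans hb) hN0.le
  obtain ⟨hρ0, hρ1⟩ := gaugeR_dim_coef_lt_one (N := N) hd hK0 hb₁N hdoor
  have hκ : 0 < dimκ(d, K * (b₁ / N)) := StarDimLimit.dimRate_pos (d := d) hρ0 hρ1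
  set κ := dimκ(d, K * (b₁ / N)) with hκdef
  obtain ⟨hWq, hWqm, hWq1, hq1, hcq⟩ := plaquetteObs_data_dim (N := N) q
  obtain ⟨hWr, hWrm, hWr1, hr1, hcr⟩ := plaquetteObs_data_dim (N := N) r
  set M : ℝ≥0 := ⟨|F 1| + 2 * KF, by positivity⟩ with hMdef
  have hMR : (M : ℝ) = |F 1| + 2 * KF := rfl
  have hFM : ∀ U, |F U| ≤ (M : ℝ) := fun U => hF.abs_le U
  -- base-point distances and the triangle inequality
  set a : ℕ := Literature.Probability.LatticeModels.Site.supNorm (x₀ - q.1) with ha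
  set b' : ℕ := Literature.Probability.LatticeModels.Site.supNorm (x₀ - r.1) with hb'
  set c : ℕ := Literature.Probability.LatticeModels.Site.supNorm (q.1 - r.1) with hc
  have haR : ‖x₀ - q.1‖ = a := Literature.Probability.LatticeModels.Site.norm_eq_supNorm _
  have hbR : ‖x₀ - r.1‖ = b' := Literature.Probability.LatticeModels.Site.norm_eq_supNorm _
  have hcR : ‖q.1 - r.1‖ = c := Literature.Probability.LatticeModels.Site.norm_eq_supNorm _
  have hcR' : Literature.Probability.LatticeModels.Site.supNorm (r.1 - q.1) = c := by
    have h : ‖r.1 - q.1‖ = (Literature.Probability.LatticeModels.Site.supNorm (r.1 - q.1) : ℝ) :=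
      Literature.Probability.LatticeModels.Site.norm_eq_supNorm _
    rw [norm_sub_rev, hcR] at h
    exact_mod_cast h.symm
  have haR' : Literature.Probability.LatticeModels.Site.supNorm (q.1 - x₀) = a := by
    have h : ‖q.1 - x₀‖ = (Literature.Probability.LatticeModels.Site.supNorm (q.1 - x₀) : ℝ) :=
      Literature.Probability.LatticeModels.Site.norm_eq_supNorm _
    rw [norm_sub_rev, haR] at h
    exact_mod_cast h.symm
  have hbR' : Literature.Probability.LatticeModels.Site.supNorm (r.1 - x₀) = b' := by
    have h : ‖r.1 - x₀‖ = (Literature.Probability.LatticeModels.Site.supNorm (r.1 - x₀) : ℝ) :=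
      Literature.Probability.LatticeModels.Site.norm_eq_supNorm _
    rw [norm_sub_rev, hbR] at h
    exact_mod_cast h.symm
  have htri : (a : ℝ) ≤ b' + c := by
    rw [← haR, ← hbR, ← hcR]
    calc ‖x₀ - q.1‖ = ‖(x₀ - r.1) - (q.1 - r.1)‖ := by congr 1; abel
      _ ≤ ‖x₀ - r.1‖ + ‖q.1 - r.1‖ := norm_sub_le _ _
  -- separations for the three splits
  have hA_Λ : ∀ e ∈ Λ, ∀ e' ∈ plaquetteEdges r, ((min b' c - (D + 2) : ℕ) : ℝ) ≤ ‖e.1 - e'.1‖ :=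
    sep_of_near_dim hD hr1 (by rw [← hb']; omega)
  have hA_q : ∀ e ∈ plaquetteEdges q, ∀ e' ∈ plaquetteEdges r, ((min b' c - (D + 2) : ℕ) : ℝ) ≤ ‖e.1 - e'.1‖ :=
    sep_of_near_dim hq1 hr1 (by rw [← hc]; omega)
  have hB_Λ : ∀ e ∈ Λ, ∀ e' ∈ plaquetteEdges q, ((min a c - (D + 2) : ℕ) : ℝ) ≤ ‖e.1 - e'.1‖ :=
    sep_of_near_dim hD hq1 (by rw [← ha]; omega)
  have hB_r : ∀ e ∈ plaquetteEdges r, ∀ e' ∈ plaquetteEdges q, ((min a c - (D + 2) : ℕ) : ℝ) ≤ ‖e.1 - e'.1‖ :=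
    sep_of_near_dim hr1 hq1 (by rw [hcR']; omega)
  have hC_q : ∀ e ∈ plaquetteEdges q, ∀ e' ∈ Λ, ((min a b' - (D + 2) : ℕ) : ℝ) ≤ ‖e.1 - e'.1‖ :=
    sep_of_near_dim hq1 hD (by rw [haR']; omega)
  have hC_r : ∀ e ∈ plaquetteEdges r, ∀ e' ∈ Λ, ((min a b' - (D + 2) : ℕ) : ℝ) ≤ ‖e.1 - e'.1‖ :=
    sep_of_near_dim hr1 hD (by rw [hbR']; omega)
  -- the three split bounds
  have SA := abs_threePoint_le_of_sep_dim hd hN hK0 hmod hR hdoor h0 hb hμ hF hWq hWr hFM hWq1 hA_Λ hA_q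
  have SB := abs_threePoint_le_of_sep_dim hd hN hK0 hmod hR hdoor h0 hb hμ hF hWr hWq hFM hWr1 hB_Λ hB_r
  have SC := abs_threePoint_le_of_sep_dim hd hN hK0 hmod hR hdoor h0 hb hμ hWq hWr hF hWq1 hWr1 hC_q hC_r
  rw [← threePoint_swap hF.measurable hWqm hWrm hFM hWq1 hWr1] at SB
  rw [← threePoint_rotate hF.measurable hWqm hWrm hFM hWq1 hWr1] at SC
  -- ONE constant `P` for the three brackets (plaquette constant `w = 4N³` as a real number)
  have e4 : ((4 * (N : ℝ≥0) ^ 3 : ℝ≥0) : ℝ) = 4 * (N : ℝ) ^ 3 := by push_cast; ring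
  rw [e4] at SA SB SC
  have hw0 : (0 : ℝ) ≤ 4 * (N : ℝ) ^ 3 := by positivity
  set P : ℝ := 4 * (4 * (N : ℝ) ^ 3) * (((Λ.card : ℝ) + 4) * (4 * (N : ℝ) ^ 3 * (M : ℝ) + (KF : ℝ))) +
    16 * (M : ℝ) * (4 * (N : ℝ) ^ 3) ^ 2 + 24 * (4 * (N : ℝ) ^ 3) * ((Λ.card : ℝ) * (KF : ℝ)) with hP
  have e1 : ((1 : ℝ≥0) : ℝ) = 1 := by norm_num
  have hΛ0 : (0 : ℝ) ≤ Λ.card := Nat.cast_nonneg _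
  have hcq0 : (0 : ℝ) ≤ (plaquetteEdges q).card := Nat.cast_nonneg _
  have hcr0 : (0 : ℝ) ≤ (plaquetteEdges r).card := Nat.cast_nonneg _
  have hbrA := bracket_plaquette_le_gen (L := (Λ.card : ℝ)) (Kr := (KF : ℝ)) (Mr := (M : ℝ)) (w := 4 * (N : ℝ) ^ 3)
    e1 hw0 hΛ0 KF.2 M.2 hcq0 hcq hcr0 hcr
  have hbrB := bracket_plaquette_le_gen (L := (Λ.card : ℝ)) (Kr := (KF : ℝ)) (Mr := (M : ℝ)) (w := 4 * (N : ℝ) ^ 3)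
    e1 hw0 hΛ0 KF.2 M.2 hcr0 hcr hcq0 hcq
  have hbrC := bracket_cylinder_le_gen (L := (Λ.card : ℝ)) (Kr := (KF : ℝ)) (Mr := (M : ℝ)) (w := 4 * (N : ℝ) ^ 3)
    e1 hw0 hΛ0 KF.2 M.2 hcq hcr
  have hP0 : 0 ≤ P := by rw [hP]; positivity
  rw [← hP] at hbrA hbrB hbrC
  set C₀ : ℝ := 4 * (2 * Real.sqrt N) ^ 2 with hC₀
  have hC₀0 : 0 ≤ C₀ := by rw [hC₀]; positivity
  have TA := SA.trans ((mul_le_mul_of_nonneg_left hbrA (mul_nonneg hC₀0 (Real.exp_pos _).le)).trans_eq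
    (mul_right_comm _ _ _))
  have TB := SB.trans ((mul_le_mul_of_nonneg_left hbrB (mul_nonneg hC₀0 (Real.exp_pos _).le)).trans_eq
    (mul_right_comm _ _ _))
  have TC := SC.trans ((mul_le_mul_of_nonneg_left hbrC (mul_nonneg hC₀0 (Real.exp_pos _).le)).trans_eq
    (mul_right_comm _ _ _))
  have key := tree_bound_of_three_splits (D := D) (mul_nonneg hC₀0 hP0) hκ.le htri TA TB TC
  refine key.trans ?_
  have hpre : 0 ≤ C₀ * P * Real.exp (κ * (D + 4)) := mul_nonneg (mul_nonneg hC₀0 hP0) (Real.exp_pos _).le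
  have ea := exp_neg_quarter_supNorm_le_pow_dim hκ.le (by omega : 1 ≤ d) (x₀ - q.1)
  have eb := exp_neg_quarter_supNorm_le_pow_dim hκ.le (by omega : 1 ≤ d) (x₀ - r.1)
  have ec := exp_neg_quarter_supNorm_le_pow_dim hκ.le (by omega : 1 ≤ d) (q.1 - r.1)
  rw [haR] at ea; rw [hbR] at eb; rw [hcR] at ec
  calc C₀ * P * Real.exp (κ * (D + 4)) * Real.exp (-(κ / 4 * a)) *
        (Real.exp (-(κ / 4 * b')) + Real.exp (-(κ / 4 * c)))
      ≤ C₀ * P * Real.exp (κ * (D + 4)) * Real.exp (-(κ / (4 * d))) ^ l1 (x₀ - q.1) *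
        (Real.exp (-(κ / (4 * d))) ^ l1 (x₀ - r.1) + Real.exp (-(κ / (4 * d))) ^ l1 (q.1 - r.1)) := by
        rw [mul_assoc (C₀ * P * Real.exp (κ * (D + 4))), mul_assoc (C₀ * P * Real.exp (κ * (D + 4)))]
        refine mul_le_mul_of_nonneg_left ?_ hpre
        exact mul_le_mul ea (add_le_add eb ec) (by positivity) (by positivity)
    _ = _ := by rw [hC₀, hP, hMR]; ring

/-- ★ **C-SUS3 FOR `SU(N)` — absolute summability of the connected three-point function in the last plaquette**, with
`Σ_r |u₃(F; W_q; W_r)| ≤ 2 A_N D₄((1+r)/(1−r))⁴ r^{‖x₀−x_q‖₁}` (summable again in `q`), for the DLR state at any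
`0 ≤ b ≤ b₁` of the modulus window. -/
theorem summable_threePoint_dim (hd : 2 ≤ d) (hN : 1 ≤ N) {R K b₁ : ℝ} (hK0 : 0 ≤ K)
    (hmod : OneLinkKRModulus N R K) (hR : b₁ / N * (2 * ((d : ℝ) - 1)) ≤ R) (hdoor : doorPoly d (K * (b₁ / N)) < 1) {b : ℝ} (h0 : 0 ≤ b) (hb : b ≤ b₁)
    {μ : Measure (LGConfig d (Matrix.specialUnitaryGroup (Fin N) ℂ))}
    (hμ : μ ∈ ymGibbsMeasures (d := d) (fundamentalRep (Fin N)) b)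
    {F : LGConfig d (Matrix.specialUnitaryGroup (Fin N) ℂ) → ℝ} {Λ : Finset (ZdEdge d)} {KF : ℝ≥0}
    (hF : IsLipschitzCylinder (fundamentalRep (Fin N)) F Λ KF)
    {x₀ : Literature.Probability.LatticeModels.Site d} {D : ℕ} (hD : ∀ e ∈ Λ, ‖e.1 - x₀‖ ≤ D)
    (q : ZdPlaquette d) :
    Summable (fun r : ZdPlaquette d => cov[fun U => F U * (W∗ q) U, W∗ r; μ] -
        (∫ U, F U ∂μ) * cov[W∗ q, W∗ r; μ] - (∫ U, (W∗ q) U ∂μ) * cov[F, W∗ r; μ]) ∧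
      ∑' r : ZdPlaquette d, |cov[fun U => F U * (W∗ q) U, W∗ r; μ] -
        (∫ U, F U ∂μ) * cov[W∗ q, W∗ r; μ] - (∫ U, (W∗ q) U ∂μ) * cov[F, W∗ r; μ]| ≤
      2 * (4 * (2 * Real.sqrt N) ^ 2 * Real.exp (dimκ(d, K * (b₁ / N)) * (D + 4)) *
        (4 * (4 * (N : ℝ) ^ 3) * (((Λ.card : ℝ) + 4) * (4 * (N : ℝ) ^ 3 * (|F 1| + 2 * KF) + KF)) +
          16 * (|F 1| + 2 * KF) * (4 * (N : ℝ) ^ 3) ^ 2 + 24 * (4 * (N : ℝ) ^ 3) * ((Λ.card : ℝ) * KF))) *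
        (numOrient d * ((1 + Real.exp (-(dimκ(d, K * (b₁ / N)) / (4 * d)))) /
          (1 - Real.exp (-(dimκ(d, K * (b₁ / N)) / (4 * d))))) ^ d) *
        Real.exp (-(dimκ(d, K * (b₁ / N)) / (4 * d))) ^ l1 (x₀ - q.1) := by
  have hN0 : (0 : ℝ) < N := by exact_mod_cast (show 0 < N by omega)
  have hb₁N : 0 ≤ b₁ / N := div_nonneg (h0.trans hb) hN0.le
  obtain ⟨hρ0, hρ1⟩ := gaugeR_dim_coef_lt_one (N := N) hd hK0 hb₁N hdoor
  have hκ : 0 < dimκ(d, K * (b₁ / N)) := StarDimLimit.dimRate_pos (d := d) hρ0 hρ1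
  set ρ : ℝ := Real.exp (-(dimκ(d, K * (b₁ / N)) / (4 * d))) with hρ
  set A : ℝ := 4 * (2 * Real.sqrt N) ^ 2 * Real.exp (dimκ(d, K * (b₁ / N)) * (D + 4)) *
    (4 * (4 * (N : ℝ) ^ 3) * (((Λ.card : ℝ) + 4) * (4 * (N : ℝ) ^ 3 * (|F 1| + 2 * KF) + KF)) +
      16 * (|F 1| + 2 * KF) * (4 * (N : ℝ) ^ 3) ^ 2 + 24 * (4 * (N : ℝ) ^ 3) * ((Λ.card : ℝ) * KF)) with hA
  have hρ0' : 0 ≤ ρ := (Real.exp_pos _).le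
  have hρ1' : ρ < 1 := Real.exp_lt_one_iff.2 (by
    have hd0 : (0 : ℝ) < d := by exact_mod_cast (show 0 < d by omega)
    exact neg_neg_of_pos (div_pos hκ (by positivity)))
  have hK0' : (0 : ℝ) ≤ KF := KF.2
  have hA0 : 0 ≤ A := by positivity
  have hAq : 0 ≤ A * ρ ^ l1 (x₀ - q.1) := by positivity
  have h₀ := summable_and_tsum_base_le (d := d) hAq hρ0' hρ1' x₀
  have h₁ := summable_and_tsum_base_le (d := d) hAq hρ0' hρ1' q.1
  have hpt : ∀ r : ZdPlaquette d, |cov[fun U => F U * (W∗ q) U, W∗ r; μ] -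
      (∫ U, F U ∂μ) * cov[W∗ q, W∗ r; μ] - (∫ U, (W∗ q) U ∂μ) * cov[F, W∗ r; μ]| ≤
      A * ρ ^ l1 (x₀ - q.1) * ρ ^ l1 (x₀ - r.1) + A * ρ ^ l1 (x₀ - q.1) * ρ ^ l1 (q.1 - r.1) := by
    intro r
    have h := abs_threePoint_le_dim hd hN hK0 hmod hR hdoor h0 hb hμ hF hD q r
    rw [← hρ, ← hA] at h
    linarith
  have hsumB : Summable fun r : ZdPlaquette d =>
      A * ρ ^ l1 (x₀ - q.1) * ρ ^ l1 (x₀ - r.1) + A * ρ ^ l1 (x₀ - q.1) * ρ ^ l1 (q.1 - r.1) := h₀.1.add h₁.1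
  have hsum : Summable fun r : ZdPlaquette d => |cov[fun U => F U * (W∗ q) U, W∗ r; μ] -
      (∫ U, F U ∂μ) * cov[W∗ q, W∗ r; μ] - (∫ U, (W∗ q) U ∂μ) * cov[F, W∗ r; μ]| :=
    Summable.of_nonneg_of_le (fun r => abs_nonneg _) hpt hsumB
  refine ⟨hsum.of_abs, ?_⟩
  calc _ ≤ ∑' r : ZdPlaquette d, (A * ρ ^ l1 (x₀ - q.1) * ρ ^ l1 (x₀ - r.1) +
        A * ρ ^ l1 (x₀ - q.1) * ρ ^ l1 (q.1 - r.1)) := hsum.tsum_le_tsum hpt hsumB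
    _ = (∑' r : ZdPlaquette d, A * ρ ^ l1 (x₀ - q.1) * ρ ^ l1 (x₀ - r.1)) +
        ∑' r : ZdPlaquette d, A * ρ ^ l1 (x₀ - q.1) * ρ ^ l1 (q.1 - r.1) := h₀.1.tsum_add h₁.1
    _ ≤ A * ρ ^ l1 (x₀ - q.1) * (numOrient d * ((1 + ρ) / (1 - ρ)) ^ d) +
        A * ρ ^ l1 (x₀ - q.1) * (numOrient d * ((1 + ρ) / (1 - ρ)) ^ d) := add_le_add h₀.2 h₁.2
    _ = _ := by ring

end Summit.Ventures.YMGap.CouplingResponse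

end
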